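import Summits.Ventures.PercRepro.ProfilePointedCircuitClassesStarSharpParXE

/-!
# PercRepro — THE REGIME `b ∥ y`, `y ∈ X`, OF CASE D0, PART F: THE REGIME THEOREM
(p5, gen 55; `proofs/P5-GM1.md` §82 ADD 7)

`inCount_thru_le_of_par_X`: if `b` is parallel to a point `y` of `X` in `N ／ b′` (`ρ{y, b, b′} = 2`, `ρ{b, b′} = 2`),
the `b′`-avoiding inequality holds — the assembly of the regime `b ∥ e` with a fifth kind of target on the right-hand
side (the OFF C-targets `{e, f, x} + b` with bi-independent complement) and the bound of part E for the bad demands.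
-/

open scoped Matroid

namespace PercRepro.Cogirth

open Finset ThmH Skew Shadow Profile

open Classical

variable {α : Type} [DecidableEq α] {N : Matroid α} [N.Finite]

section StarSharpParXF

variable {b b' : α}

/-- **THE REGIME `b ∥ y`, `y ∈ X`** (`ρ{y, b, b′} = 2`, `ρ{b, b′} = 2`): the `b′`-avoiding inequality. -/
theorem inCount_thru_le_of_par_X (hn : (gr N).card = 9) (h : SeriesPair N b b')
    {e f : α} (he : e ∈ gr N) (hf : f ∈ gr N) (hef : e ≠ f) (heb : e ≠ b) (heb' : e ≠ b') (hfb : f ≠ b) (hfb' : f ≠ b')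
    (he1 : ∀ y ∈ ((((gr N).erase b).erase b').erase f).erase e, rk N {e, y} = 2)
    (hf1 : ∀ y ∈ ((((gr N).erase b).erase b').erase f).erase e, rk N {f, y} = 2)
    (hfc : ∀ y ∈ ((((gr N).erase b).erase b').erase f).erase e, rk N (((((gr N).erase b).erase b').erase f).erase y) = 4)
    (hX : rk N (((((gr N).erase b).erase b').erase f).erase e) = 4) (hef2 : rk N {e, f} = 2)
    {y : α} (hyX : y ∈ ((((gr N).erase b).erase b').erase f).erase e) (hpar : rk N {y, b, b'} = 2)
    (hbb2 : rk N {b, b'} = 2) :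
    inCount N 4 e + thruCount N 4 {b', f} + thruCount N 4 {b', e, f} ≤
      inCount N 4 f + thruCount N 4 {e, f} + thruCount N 4 {b', e} := by
  -- THE ASSEMBLY (as in D0R)
  rw [inCount_thru_split']
  have hsplit := card_filter_add_card_filter_not (s := (biIndepSets N 4).filter (fun W => (e ∈ W ∧ f ∉ W) ∧ b' ∉ W))
    (fun W => (gr N \ W).erase b' ∈ biIndepSets N 4)
  simp only [filter_filter] at hsplit
  have htar : ((biIndepSets N 4).filter (fun W => (f ∈ W ∧ b' ∉ W) ∧ (e ∉ W ∧ (gr N \ W).erase b' ∈ biIndepSets N 4))).card +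
      ((biIndepSets N 4).filter (fun W => (f ∈ W ∧ b' ∉ W) ∧ (e ∉ W ∧ b ∈ W ∧ ¬ (gr N \ W).erase b' ∈ biIndepSets N 4))).card +
      ((biIndepSets N 4).filter (fun W => (f ∈ W ∧ b' ∉ W) ∧ (e ∈ W ∧ b ∉ W))).card +
      ((biIndepSets N 4).filter (fun W => (f ∈ W ∧ b' ∉ W) ∧ (e ∈ W ∧ b ∈ W ∧ ¬ (gr N \ W).erase b' ∈ biIndepSets N 4))).card +
      ((biIndepSets N 4).filter (fun W => (f ∈ W ∧ b' ∉ W) ∧ (e ∈ W ∧ b ∈ W ∧ (gr N \ W).erase b' ∈ biIndepSets N 4))).card ≤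
      ((biIndepSets N 4).filter (fun W => f ∈ W ∧ b' ∉ W)).card := by
    rw [← card_union_of_disjoint, ← card_union_of_disjoint, ← card_union_of_disjoint, ← card_union_of_disjoint]
    · apply card_le_card
      intro W hW
      simp only [mem_union, mem_filter] at hW ⊢
      rcases hW with (((hW | hW) | hW) | hW) | hW <;> exact ⟨hW.1, hW.2.1⟩
    · rw [disjoint_union_left, disjoint_union_left, disjoint_union_left]
      refine ⟨⟨⟨?_, ?_⟩, ?_⟩, ?_⟩ <;> rw [disjoint_filter]
      · rintro W _ ⟨-, heW, -⟩ ⟨-, heW', -, -⟩; exact heW heW'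
      · rintro W _ ⟨-, heW, -, -⟩ ⟨-, heW', -, -⟩; exact heW heW'
      · rintro W _ ⟨-, -, hbW⟩ ⟨-, -, hbW', -⟩; exact hbW hbW'
      · rintro W _ ⟨-, -, -, hc⟩ ⟨-, -, -, hc'⟩; exact hc hc'
    · rw [disjoint_union_left, disjoint_union_left]
      refine ⟨⟨?_, ?_⟩, ?_⟩ <;> rw [disjoint_filter]
      · rintro W _ ⟨-, heW, -⟩ ⟨-, heW', -, -⟩; exact heW heW'
      · rintro W _ ⟨-, heW, -, -⟩ ⟨-, heW', -, -⟩; exact heW heW'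
      · rintro W _ ⟨-, -, hbW⟩ ⟨-, -, hbW', -⟩; exact hbW hbW'
    · rw [disjoint_union_left]
      refine ⟨?_, ?_⟩ <;> rw [disjoint_filter]
      · rintro W _ ⟨-, heW, -⟩ ⟨-, heW', -⟩; exact heW heW'
      · rintro W _ ⟨-, heW, -, -⟩ ⟨-, heW', -⟩; exact heW heW'
    · rw [disjoint_filter]
      rintro W _ ⟨-, -, hc⟩ ⟨-, -, -, hc'⟩; exact hc' hc
  have hinj1 := card_off_demands_le (N := N) (b' := b') (e := e) hf hfb'
  have hs1 := card_filter_add_card_filter_not (s := d0DON N b' e f) (fun W => d0c0 N b b' e f W)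
  have hs2 := card_filter_add_card_filter_not (s := (d0DON N b' e f).filter (fun W => ¬ d0c0 N b b' e f W))
    (fun W => d0c1 N b e f W ∧ d0c2 N b b' e f W)
  simp only [filter_filter] at hs2
  have hshape : (d0DON N b' e f).filter (fun W => ¬ d0c0 N b b' e f W ∧ (d0c1 N b e f W ∧ d0c2 N b b' e f W)) =
      (d0DON N b' e f).filter (fun W => (¬ d0c0 N b b' e f W ∧ d0c1 N b e f W) ∧ d0c2 N b b' e f W) :=
    filter_congr (fun W _ => and_assoc.symm)
  rw [hshape] at hs2
  have hinjR0 := d0_injR0 h hn he hf hef heb heb' hfb hfb'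
  have hinjR2 := d0_injR2'' hn h he hf hef heb heb' hfb hfb'
  have hsB := card_filter_add_card_filter_not
    (s := (biIndepSets N 4).filter (fun W => (f ∈ W ∧ b' ∉ W) ∧ (e ∈ W ∧ b ∉ W)))
    (fun B => insert b (B.erase f) ∈ biIndepSets N 4 ∧ rk N (insert b (insert b' (B.erase f))) = 4)
  simp only [filter_filter] at hsB
  have hDON : (d0DON N b' e f).card = ((biIndepSets N 4).filter (fun W => ((e ∈ W ∧ f ∉ W) ∧ b' ∉ W) ∧
      ¬ (gr N \ W).erase b' ∈ biIndepSets N 4)).card := rfl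
  rw [← hDON] at hsplit
  -- THE BAD DEMANDS (part E)
  have hbad := parX_card_bad_le hn h he hf hef heb heb' hfb hfb' he1 hf1 hfc hX hef2 hyX hpar hbb2
  have hs2' : ((d0DON N b' e f).filter (fun W => (¬ d0c0 N b b' e f W ∧ d0c1 N b e f W) ∧ d0c2 N b b' e f W)).card +
      ((d0DON N b' e f).filter (fun W => ¬ d0c0 N b b' e f W ∧ ¬ (d0c1 N b e f W ∧ d0c2 N b b' e f W))).card =
      ((d0DON N b' e f).filter (fun W => ¬ d0c0 N b b' e f W)).card := by
    rw [← hs2]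
  have hsum := Nat.add_le_add hinjR0 (Nat.add_le_add hinjR2 hbad)
  omega

end StarSharpParXF

end PercRepro.Cogirth
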